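import Summits.QuantumFields.BalabanUV.Beta.GAN24.MonotoneTorusSqueeze
import Literature.MathematicalPhysics.QuantumFieldTheory.Balaban1983to89.B5Hk163TorusHolder

/-!
# `BalabanUV.Beta.GAN24.WhitneyRowDefectBound` — binder row G-an2-4 ∕ (CONV-C), routes R1 ∕ R6 ∕ R7 at `U = 1`: THE SIZE OF THE HONEST ROW DEFECT
# `δ_j(B) = Q_{Lc^{j+1}}(PcoMat j (H_{Lc^j}B)) − B` OF BAŁABAN's MINIMISER UNDER WHITNEY PROLONGATION — `nsq δ_j(B) ≤ ρ_j²·nsq B`,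
# `ρ_j = |T₁×{1..d}|·(Lc + d)·C_H(d,0)·Lc^{−j}`: FIRST ORDER IN `η_j = Lc^{−j}`, every torus, every `Lc ≥ 1`, every `d`, hypothesis-free
# (unit b2b-balaban-gan24-p3, gen 49; v1 — companion of `WhitneyRowDefectGauge`)

NOT IN PRINT; OUR PROOF ([folklore] finite sums over TREE objects BY NAME).  HONEST FRAMING (cell contract, verbatim): «discharging `BetaPertH` makes Bałaban's UV
stability UNCONDITIONAL — a real constructive-QFT result; it is NOT the continuum limit and NOT the Clay problem.»  HONEST DEPENDENCY (verbatim): «continuum YM on T⁴ ⇐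
BetaPertH ∧ nine spine estimates (0/9 proved); BetaPertH ⇐ (D1) ∧ (D4) ∧ CAP+tail; G-an2-4 gates asym, D1 and NE2/3/4.»

THE MECHANISM (three tree facts, by name).  (1.17) `sread (j+1) = sread j·cstep j` (`MonotoneTorusTower.sread_comp`) factors the defect through ONE Bałaban step:
`δ_j(B) = sread j ((cstep j·PcoMat j − 1)(H_{Lc^j}B))`.  The composite «prolongate by Whitney, average back one step» reads, at a level-`j` bond `(z, ν)`, an AVERAGE
(weights `Lc^{−(d+1)}` × tensor weights `vwt ≥ 0`, total ONE) of values `A(par q + vtx T, ν)` at the King parents `par q` of the `Lc^{d+1}` sample points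
`q = Lc·z + jj + t e_ν` of the line sums (1.18) — and `par q = z + c e_ν` with `c ≤ t < Lc` (`BlockPairingGeometry.par_add_unitVec`, `par_cpt_add_off`): every value read
lies within `Lc + d` unit steps of `z` along a monotone staircase.  One unit step of Bałaban's minimiser costs `C_H(d,0)∕n·Σ|B|` uniformly (b05's sup bound of the
gradient kernel `B5Hk163TorusHolder.norm_fdiff_HkOp_mulVec_le`, `n = Lc^j`).  Hence `|((cstep·PcoMat − 1)H B)(z,ν)| ≤ (Lc + d)·C_H(d,0)∕Lc^j·Σ|B|`, the reading `sread j`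
is an average, and Cauchy–Schwarz on the unit torus closes `nsq δ_j(B) ≤ ρ_j²·nsq B`.

WHAT THIS FILE PROVES (0 sorry, 0 `def`, nothing cited):
* §1 `norm_HkOp_step_le`, `norm_HkOp_tstep_le`, `norm_HkOp_vtx_le` — oscillation of `H_nB` over unit steps, straight runs and cube vertices (sup currency, `C_H(d,0)∕n·Σ|B|` per step).
* §2 `castS_symm_sites_symm_bpt_tstep` (the cstep sample points in the Whitney torus: `Lc·z + jj + t e_ν = cpt z + off jj + t e_ν`), `par_cpt_add_off_tstep` (`par = z + c e_ν`, `c ≤ t`),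
  `cstep_mulVec_apply`, `PcoMat_mulVec_apply`.
* §3 **`norm_cstep_PcoMat_sub_le`** (the pointwise defect of «prolongate, then average one step» on `H_{Lc^j}B`), `norm_sread_mulVec_le` (the reading is an average),
  `honestDefect_eq_sread` ((1.17)).
* §4 **`nsq_honestDefect_le`**: `nsq (sread (j+1) (PcoMat j (H_{Lc^j}B)) − B) ≤ (|T₁×{1..d}|·(Lc + d)·C_H(d,0)∕Lc^j)²·nsq B`.
HONEST SCOPE.  FIRST order (`Lc^{−j}`), not the numerically observed `Lc^{−2j}` ((P-R1c)); the constant carries the unit-torus VOLUME `|T₁×{1..d}|` (the crude sup bound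
`norm_dker_le` is used, not the decaying `norm_dker_bpt_le` — the volume-free version is routine and ON REQUEST); (CONV-C)'s row text allows `C₄(d, L, N)`.
`U = 1`, torus model; NOT (CONV-C), NOT D1, NOT `BetaPertH`, NOT continuum, NOT Clay; NEVER «G-an2-4 closed».
-/

noncomputable section

namespace Summit.QuantumFields.BalabanUV.Beta.GAN24.WhitneyRowDefectBound

open Matrix Finset
open scoped BigOperators ComplexOrder
open Literature.MathematicalPhysics.QuantumFieldTheory.Balaban1983to89
open Literature.MathematicalPhysics.QuantumFieldTheory.Balaban1983to89.B5Prop11Plancherel (Tor fine unitVec)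
open Literature.MathematicalPhysics.QuantumFieldTheory.Balaban1983to89.B5Prop11Lower (nsq nsq_nonneg)
open Literature.MathematicalPhysics.QuantumFieldTheory.Balaban1983to89.B5Block118 (QvOp QvOp_mulVec lineSum bpt tstep tstep_zero tstep_succ)
open Literature.MathematicalPhysics.QuantumFieldTheory.Balaban1983to89.B5Blocks16 (bpt_eq_natCast)
open Literature.MathematicalPhysics.QuantumFieldTheory.Balaban1983to89.B5Action121 (fdiff_mulVec_apply sdiff_mulVec comp)
open Literature.MathematicalPhysics.QuantumFieldTheory.Balaban1983to89.B5Composition116 (recast recast_apply sites sitesV sitesV_symm_apply fine_fine)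
open Literature.MathematicalPhysics.QuantumFieldTheory.Balaban1983to89.B5G183RateTorus (cpt)
open Literature.MathematicalPhysics.QuantumFieldTheory.Balaban1983to89.B5G183RateTorusW (off)
open Literature.MathematicalPhysics.QuantumFieldTheory.Balaban1983to89.B5Hk163Torus (HkOp QvOp_HkOp_mulVec)
open Literature.MathematicalPhysics.QuantumFieldTheory.Balaban1983to89.B5Hk163Holder (CHolder163)
open Literature.MathematicalPhysics.QuantumFieldTheory.Balaban1983to89.B5Hk163TorusHolder (norm_fdiff_HkOp_mulVec_le)
open Summit.QuantumFields.BalabanUV.T4Continuum.BalabanAveragedTowerModes (par par_cpt_add_off)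
open Summit.QuantumFields.BalabanUV.T4Continuum.BlockPairingGeometry (par_add_unitVec)
open Summit.QuantumFields.BalabanUV.Beta.GAN24.MonotoneTorusTower (Lev sread cstep sread_comp)
open Summit.QuantumFields.BalabanUV.Beta.GAN24.MultilinearProlongation (vtx vtx_insert vwt sum_vwt vwt_nonneg twR twR_nonneg twR_le_one icore)
open Summit.QuantumFields.BalabanUV.Beta.GAN24.CochainProlongation (icT Pco)
open Summit.QuantumFields.BalabanUV.Beta.GAN24.MonotoneTorusSqueeze (castS PcoLev PcoMat PcoMat_mulVec)

variable {d : ℕ}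

/-! ## §1 Oscillation of Bałaban's minimiser over unit steps (sup currency) -/

section Osc

variable (n : ℕ) [NeZero n] (M : Fin d → ℕ) [hM : ∀ μ, NeZero (M μ)]

/-- **ONE UNIT STEP**: `|(H_nB)_μ(x + e_ν) − (H_nB)_μ(x)| ≤ C_H(d,0)∕n · Σ_{y,λ}|B_λ(y)|` — b05's sup bound of the gradient kernel
(`B5Hk163TorusHolder.norm_fdiff_HkOp_mulVec_le`), divided by the unit `n` of `∂^η`. [folklore] -/
theorem norm_HkOp_step_le (B : Tor M × Fin d → ℂ) (x : Tor (fine n M)) (μ ν : Fin d) :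
    ‖(HkOp n M *ᵥ B) (x + unitVec (fine n M) ν, μ) - (HkOp n M *ᵥ B) (x, μ)‖
      ≤ CHolder163 d 0 / n * ∑ y : Tor M, ∑ lam : Fin d, ‖B (y, lam)‖ := by
  have hn : (0 : ℝ) < n := Nat.cast_pos.mpr (Nat.pos_of_ne_zero (NeZero.ne n))
  have h := norm_fdiff_HkOp_mulVec_le n M B μ ν x
  rw [fdiff_mulVec_apply, sdiff_mulVec, norm_mul, Complex.norm_natCast] at h
  rw [div_mul_eq_mul_div, le_div_iff₀ hn, mul_comm]
  exact h

/-- **A STRAIGHT RUN of `c` unit steps**: `|(H_nB)_μ(x + c e_ν) − (H_nB)_μ(x)| ≤ c · C_H(d,0)∕n · Σ|B|`. [folklore] -/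
theorem norm_HkOp_tstep_le (B : Tor M × Fin d → ℂ) (x : Tor (fine n M)) (μ ν : Fin d) (c : ℕ) :
    ‖(HkOp n M *ᵥ B) (x + tstep (fine n M) ν c, μ) - (HkOp n M *ᵥ B) (x, μ)‖
      ≤ c * (CHolder163 d 0 / n * ∑ y : Tor M, ∑ lam : Fin d, ‖B (y, lam)‖) := by
  induction c with
  | zero => simp [tstep_zero]
  | succ c ih =>
      rw [tstep_succ, ← add_assoc]
      calc ‖(HkOp n M *ᵥ B) (x + tstep (fine n M) ν c + unitVec (fine n M) ν, μ) - (HkOp n M *ᵥ B) (x, μ)‖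
          ≤ ‖(HkOp n M *ᵥ B) (x + tstep (fine n M) ν c + unitVec (fine n M) ν, μ) - (HkOp n M *ᵥ B) (x + tstep (fine n M) ν c, μ)‖
              + ‖(HkOp n M *ᵥ B) (x + tstep (fine n M) ν c, μ) - (HkOp n M *ᵥ B) (x, μ)‖ := norm_sub_le_norm_sub_add_norm_sub _ _ _
        _ ≤ CHolder163 d 0 / n * ∑ y : Tor M, ∑ lam : Fin d, ‖B (y, lam)‖
              + c * (CHolder163 d 0 / n * ∑ y : Tor M, ∑ lam : Fin d, ‖B (y, lam)‖) := add_le_add (norm_HkOp_step_le n M B _ μ ν) ih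
        _ = ((c + 1 : ℕ) : ℝ) * (CHolder163 d 0 / n * ∑ y : Tor M, ∑ lam : Fin d, ‖B (y, lam)‖) := by push_cast; ring

/-- **A CUBE VERTEX**: `|(H_nB)_μ(x + Σ_{ν∈T} e_ν) − (H_nB)_μ(x)| ≤ |T| · C_H(d,0)∕n · Σ|B|`. [folklore] -/
theorem norm_HkOp_vtx_le (B : Tor M × Fin d → ℂ) (x : Tor (fine n M)) (μ : Fin d) (T : Finset (Fin d)) :
    ‖(HkOp n M *ᵥ B) (x + vtx (fine n M) T, μ) - (HkOp n M *ᵥ B) (x, μ)‖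
      ≤ T.card * (CHolder163 d 0 / n * ∑ y : Tor M, ∑ lam : Fin d, ‖B (y, lam)‖) := by
  induction T using Finset.induction_on with
  | empty => simp [vtx]
  | insert i T hi ih =>
      rw [vtx_insert _ hi, card_insert_of_notMem hi, show x + (unitVec (fine n M) i + vtx (fine n M) T) = x + vtx (fine n M) T + unitVec (fine n M) i by abel]
      calc ‖(HkOp n M *ᵥ B) (x + vtx (fine n M) T + unitVec (fine n M) i, μ) - (HkOp n M *ᵥ B) (x, μ)‖
          ≤ ‖(HkOp n M *ᵥ B) (x + vtx (fine n M) T + unitVec (fine n M) i, μ) - (HkOp n M *ᵥ B) (x + vtx (fine n M) T, μ)‖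
              + ‖(HkOp n M *ᵥ B) (x + vtx (fine n M) T, μ) - (HkOp n M *ᵥ B) (x, μ)‖ := norm_sub_le_norm_sub_add_norm_sub _ _ _
        _ ≤ CHolder163 d 0 / n * ∑ y : Tor M, ∑ lam : Fin d, ‖B (y, lam)‖
              + T.card * (CHolder163 d 0 / n * ∑ y : Tor M, ∑ lam : Fin d, ‖B (y, lam)‖) := add_le_add (norm_HkOp_step_le n M B _ μ i) ih
        _ = ((T.card + 1 : ℕ) : ℝ) * (CHolder163 d 0 / n * ∑ y : Tor M, ∑ lam : Fin d, ‖B (y, lam)‖) := by push_cast; ring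

end Osc

/-! ## §2 The sample points of one Bałaban step in the Whitney torus, their King parents, and the two `mulVec` formulas -/

section Geometry

variable (Lc : ℕ) [NeZero Lc] (M : Fin d → ℕ) [hM : ∀ μ, NeZero (M μ)]

/-- **THE SAMPLE POINTS**: the point `Lc·z + jj + t e_ν` of the level-`(j+1)` torus, written in b05's encoding of the one-step refinement of level `j`
(`bpt Lc (fine (Lc^j) M) z jj + t e_ν`, read through `sitesV`) IS, in the Whitney torus `Tor (fine (Lc·Lc^j) M)` of `CochainProlongation` (read through `castS`),
King's `cpt z + off jj + t e_ν` — all three encodings carry the same residues. [folklore] -/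
theorem castS_symm_sites_symm_bpt_tstep (j : ℕ) (z : Tor (fine (Lc ^ j) M)) (jj : Fin d → Fin Lc) (ν : Fin d) (t : ℕ) :
    (castS Lc M j).symm ((sites (Lc ^ j) Lc M).symm (bpt Lc (fine (Lc ^ j) M) z jj + tstep (fine Lc (fine (Lc ^ j) M)) ν t))
      = cpt (Lc ^ j) Lc M z + off (Lc ^ j) Lc M jj + tstep (fine (Lc * Lc ^ j) M) ν t := by
  rw [Equiv.symm_apply_eq, Equiv.symm_apply_eq]
  funext μ
  rw [sites, recast_apply, castS, recast_apply]
  simp only [Pi.add_apply, map_add, bpt_eq_natCast, cpt, off, tstep, map_natCast]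
  by_cases hμ : μ = ν
  · simp only [hμ, if_true, map_natCast]
    push_cast
    ring
  · simp only [hμ, if_false, map_zero]
    push_cast
    ring

/-- **THE KING PARENT OF A SAMPLE POINT**: `par (cpt z + off jj + t e_ν) = z + c e_ν` for some `c ≤ t` (`par_cpt_add_off` at `t = 0`; each further unit step moves
the parent by `0` or `e_ν`, `par_add_unitVec`). [folklore] -/
theorem par_cpt_add_off_tstep (j : ℕ) (z : Tor (fine (Lc ^ j) M)) (jj : Fin d → Fin Lc) (ν : Fin d) (t : ℕ) :
    ∃ c : ℕ, c ≤ t ∧ par (Lc ^ j) Lc M (cpt (Lc ^ j) Lc M z + off (Lc ^ j) Lc M jj + tstep (fine (Lc * Lc ^ j) M) ν t)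
      = z + tstep (fine (Lc ^ j) M) ν c := by
  induction t with
  | zero => exact ⟨0, le_rfl, by rw [tstep_zero, add_zero, par_cpt_add_off, tstep_zero, add_zero]⟩
  | succ t ih =>
      obtain ⟨c, hc, hpar⟩ := ih
      rw [tstep_succ, ← add_assoc, par_add_unitVec, hpar]
      split_ifs
      · exact ⟨c + 1, by omega, by rw [tstep_succ, add_assoc]⟩
      · exact ⟨c, by omega, rfl⟩

/-- **ONE BAŁABAN STEP READ ON THE WHITNEY TORUS**: `(cstep j A′)(z, ν) = Lc^{−(d+1)} Σ_{jj} Σ_{t<Lc} A′(Lc·z + jj + t e_ν, ν)` with the sample points written as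
`castS (cpt z + off jj + t e_ν)` ((1.18) `QvOp_mulVec` + the re-indexing `sitesV` of `cstep` + `castS_symm_sites_symm_bpt_tstep`). [folklore] -/
theorem cstep_mulVec_apply (j : ℕ) (A' : Lev Lc M (j + 1) → ℂ) (z : Tor (fine (Lc ^ j) M)) (ν : Fin d) :
    (cstep Lc M j *ᵥ A') (z, ν)
      = 1 / (Lc : ℂ) ^ (d + 1) * ∑ jj : Fin d → Fin Lc, ∑ t : Fin Lc,
          A' (castS Lc M j (cpt (Lc ^ j) Lc M z + off (Lc ^ j) Lc M jj + tstep (fine (Lc * Lc ^ j) M) ν t), ν) := by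
  have h := congrFun (Matrix.submatrix_mulVec_equiv (QvOp Lc (fine (Lc ^ j) M)) A' id (sitesV (Lc ^ j) Lc M)) (z, ν)
  refine h.trans ?_
  rw [Function.comp_apply, id, QvOp_mulVec]
  refine congrArg _ (sum_congr rfl fun jj _ => sum_congr rfl fun t _ => ?_)
  have h' := castS_symm_sites_symm_bpt_tstep Lc M j z jj ν (t : ℕ)
  rw [Equiv.symm_apply_eq] at h'
  exact congrArg (fun x => A' (x, ν)) h'

/-- **THE WHITNEY PROLONGATION AT A POINT**: `(PcoMat j A)(x′, ν) = Σ_{T ⊆ {1..d}∖{ν}} vwt T · A(par x′ + Σ_{μ∈T} e_μ, ν)` (transverse multilinear interpolation of the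
coarse `ν`-bonds of the cell of `x′`; `PcoMat_mulVec` + the definitions `PcoLev`, `Pco`, `icT`, `icore`). [folklore] -/
theorem PcoMat_mulVec_apply (j : ℕ) (A : Lev Lc M j → ℂ) (x' : Tor (fine (Lc ^ j * Lc) M)) (ν : Fin d) :
    (PcoMat Lc M j *ᵥ A) (x', ν)
      = ∑ T ∈ (univ.erase ν).powerset, (vwt (univ.erase ν) T (twR (Lc ^ j) Lc M ((castS Lc M j).symm x')) : ℂ)
          * A (par (Lc ^ j) Lc M ((castS Lc M j).symm x') + vtx (fine (Lc ^ j) M) T, ν) := by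
  rw [PcoMat_mulVec]
  rfl

end Geometry

/-! ## §3 The pointwise defect of «prolongate by Whitney, then average one Bałaban step» on Bałaban's minimiser; the reading; (1.17) -/

section Defect

variable (Lc : ℕ) [NeZero Lc] (M : Fin d → ℕ) [hM : ∀ μ, NeZero (M μ)]

/-- **THE POINTWISE DEFECT**: `|((cstep j·PcoMat j)(H_{Lc^j}B))(z, ν) − (H_{Lc^j}B)(z, ν)| ≤ (Lc + d) · C_H(d,0)∕Lc^j · Σ_{y,λ}|B_λ(y)|` — the composite is an average
(weights `Lc^{−(d+1)}·vwt ≥ 0`, total one) of values of `H_{Lc^j}B` at `par q + vtx T = z + c e_ν + Σ_{μ∈T} e_μ`, `c < Lc`, `|T| ≤ d`, each within `(c + |T|)` unit steps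
of `z` (§1, §2). [folklore] -/
theorem norm_cstep_PcoMat_sub_le (j : ℕ) (B : Tor M × Fin d → ℂ) (z : Tor (fine (Lc ^ j) M)) (ν : Fin d) :
    ‖(cstep Lc M j *ᵥ (PcoMat Lc M j *ᵥ (HkOp (Lc ^ j) M *ᵥ B))) (z, ν) - (HkOp (Lc ^ j) M *ᵥ B) (z, ν)‖
      ≤ ((Lc : ℝ) + d) * (CHolder163 d 0 / ((Lc ^ j : ℕ) : ℝ) * ∑ y : Tor M, ∑ lam : Fin d, ‖B (y, lam)‖) := by
  set A := HkOp (Lc ^ j) M *ᵥ B with hA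
  set S := CHolder163 d 0 / ((Lc ^ j : ℕ) : ℝ) * ∑ y : Tor M, ∑ lam : Fin d, ‖B (y, lam)‖ with hS
  have hS0 : 0 ≤ S := (norm_nonneg _).trans (norm_HkOp_step_le (Lc ^ j) M B z ν ν)
  -- (a) every value read is within `(Lc + d)·S` of `A (z, ν)`
  have hval : ∀ (jj : Fin d → Fin Lc) (t : Fin Lc) (T : Finset (Fin d)),
      ‖A (par (Lc ^ j) Lc M (cpt (Lc ^ j) Lc M z + off (Lc ^ j) Lc M jj + tstep (fine (Lc * Lc ^ j) M) ν t) + vtx (fine (Lc ^ j) M) T, ν)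
          - A (z, ν)‖ ≤ ((Lc : ℝ) + d) * S := by
    intro jj t T
    obtain ⟨c, hc, hpar⟩ := par_cpt_add_off_tstep Lc M j z jj ν (t : ℕ)
    rw [hpar]
    have h1 := norm_HkOp_vtx_le (Lc ^ j) M B (z + tstep (fine (Lc ^ j) M) ν c) ν T
    have h2 := norm_HkOp_tstep_le (Lc ^ j) M B z ν ν c
    have hT : (T.card : ℝ) ≤ d := by exact_mod_cast (card_le_univ T).trans_eq (Fintype.card_fin d)
    have hc' : (c : ℝ) ≤ Lc := by exact_mod_cast hc.trans t.isLt.le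
    calc ‖A (z + tstep (fine (Lc ^ j) M) ν c + vtx (fine (Lc ^ j) M) T, ν) - A (z, ν)‖
        ≤ ‖A (z + tstep (fine (Lc ^ j) M) ν c + vtx (fine (Lc ^ j) M) T, ν) - A (z + tstep (fine (Lc ^ j) M) ν c, ν)‖
            + ‖A (z + tstep (fine (Lc ^ j) M) ν c, ν) - A (z, ν)‖ := norm_sub_le_norm_sub_add_norm_sub _ _ _
      _ ≤ T.card * S + c * S := add_le_add h1 h2
      _ ≤ d * S + Lc * S := add_le_add (mul_le_mul_of_nonneg_right hT hS0) (mul_le_mul_of_nonneg_right hc' hS0)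
      _ = ((Lc : ℝ) + d) * S := by ring
  -- (b) the Whitney prolongation at each sample point is a convex combination of such values
  have hpt : ∀ (jj : Fin d → Fin Lc) (t : Fin Lc),
      ‖(PcoMat Lc M j *ᵥ A) (castS Lc M j (cpt (Lc ^ j) Lc M z + off (Lc ^ j) Lc M jj + tstep (fine (Lc * Lc ^ j) M) ν t), ν) - A (z, ν)‖
        ≤ ((Lc : ℝ) + d) * S := by
    intro jj t
    rw [PcoMat_mulVec_apply, Equiv.symm_apply_apply]
    set q := cpt (Lc ^ j) Lc M z + off (Lc ^ j) Lc M jj + tstep (fine (Lc * Lc ^ j) M) ν t with hq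
    set s := univ.erase ν with hs
    have hw0 : ∀ T ∈ s.powerset, 0 ≤ vwt s T (twR (Lc ^ j) Lc M q) := fun T hT =>
      vwt_nonneg (fun μ _ => twR_nonneg _ _ _ q μ) (fun μ _ => twR_le_one _ _ _ q μ) (mem_powerset.mp hT)
    have hw1 : ∑ T ∈ s.powerset, (vwt s T (twR (Lc ^ j) Lc M q) : ℂ) = 1 := by exact_mod_cast sum_vwt s (twR (Lc ^ j) Lc M q)
    have e : ∑ T ∈ s.powerset, (vwt s T (twR (Lc ^ j) Lc M q) : ℂ) * A (par (Lc ^ j) Lc M q + vtx (fine (Lc ^ j) M) T, ν) - A (z, ν)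
        = ∑ T ∈ s.powerset, (vwt s T (twR (Lc ^ j) Lc M q) : ℂ) * (A (par (Lc ^ j) Lc M q + vtx (fine (Lc ^ j) M) T, ν) - A (z, ν)) := by
      simp_rw [mul_sub]
      rw [sum_sub_distrib, ← sum_mul, hw1, one_mul]
    rw [e]
    refine (norm_sum_le _ _).trans ?_
    calc ∑ T ∈ s.powerset, ‖(vwt s T (twR (Lc ^ j) Lc M q) : ℂ) * (A (par (Lc ^ j) Lc M q + vtx (fine (Lc ^ j) M) T, ν) - A (z, ν))‖
        ≤ ∑ T ∈ s.powerset, vwt s T (twR (Lc ^ j) Lc M q) * (((Lc : ℝ) + d) * S) := sum_le_sum fun T hT => by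
            rw [norm_mul, Complex.norm_real, Real.norm_of_nonneg (hw0 T hT)]
            exact mul_le_mul_of_nonneg_left (hval jj t T) (hw0 T hT)
      _ = ((Lc : ℝ) + d) * S := by rw [← sum_mul, sum_vwt, one_mul]
  -- (c) the average over the `Lc^{d+1}` sample points of one Bałaban step
  rw [cstep_mulVec_apply]
  have hLcC : (Lc : ℂ) ≠ 0 := Nat.cast_ne_zero.mpr (NeZero.ne Lc)
  have hLcR : (0 : ℝ) < Lc := Nat.cast_pos.mpr (Nat.pos_of_ne_zero (NeZero.ne Lc))
  have e2 : A (z, ν) = 1 / (Lc : ℂ) ^ (d + 1) * ∑ _jj : Fin d → Fin Lc, ∑ _t : Fin Lc, A (z, ν) := by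
    rw [sum_const, card_univ, nsmul_eq_mul, sum_const, card_univ, nsmul_eq_mul, Fintype.card_fun, Fintype.card_fin, Fintype.card_fin]
    push_cast
    field_simp
    ring
  rw [e2, ← mul_sub, ← sum_sub_distrib]
  simp_rw [← sum_sub_distrib]
  calc ‖1 / (Lc : ℂ) ^ (d + 1) * ∑ jj : Fin d → Fin Lc, ∑ t : Fin Lc,
          ((PcoMat Lc M j *ᵥ A) (castS Lc M j (cpt (Lc ^ j) Lc M z + off (Lc ^ j) Lc M jj + tstep (fine (Lc * Lc ^ j) M) ν t), ν) - A (z, ν))‖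
      = 1 / (Lc : ℝ) ^ (d + 1) * ‖∑ jj : Fin d → Fin Lc, ∑ t : Fin Lc,
          ((PcoMat Lc M j *ᵥ A) (castS Lc M j (cpt (Lc ^ j) Lc M z + off (Lc ^ j) Lc M jj + tstep (fine (Lc * Lc ^ j) M) ν t), ν) - A (z, ν))‖ := by
        rw [norm_mul, norm_div, norm_one, norm_pow, Complex.norm_natCast]
    _ ≤ 1 / (Lc : ℝ) ^ (d + 1) * ∑ _jj : Fin d → Fin Lc, ∑ _t : Fin Lc, ((Lc : ℝ) + d) * S := by
        gcongr
        exact (norm_sum_le _ _).trans (sum_le_sum fun jj _ => (norm_sum_le _ _).trans (sum_le_sum fun t _ => hpt jj t))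
    _ = ((Lc : ℝ) + d) * S := by
        rw [sum_const, card_univ, nsmul_eq_mul, sum_const, card_univ, nsmul_eq_mul, Fintype.card_fun, Fintype.card_fin, Fintype.card_fin]
        push_cast
        field_simp
        ring

/-- **THE READING IS AN AVERAGE**: `|(sread j w)(y, ν)| ≤ sup |w|` ((1.18): `(Lc^j)^{−(d+1)} ×` a sum of `(Lc^j)^{d+1}` values). [folklore] -/
theorem norm_sread_mulVec_le (j : ℕ) (w : Lev Lc M j → ℂ) {W : ℝ} (hW : ∀ i, ‖w i‖ ≤ W) (y : Tor M) (ν : Fin d) :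
    ‖(sread Lc M j *ᵥ w) (y, ν)‖ ≤ W := by
  have hn : ((Lc ^ j : ℕ) : ℂ) ≠ 0 := Nat.cast_ne_zero.mpr (pow_ne_zero _ (NeZero.ne Lc))
  rw [sread, QvOp_mulVec]
  simp only [lineSum]
  calc ‖1 / ((Lc ^ j : ℕ) : ℂ) ^ (d + 1) * ∑ a : Fin d → Fin (Lc ^ j), ∑ t : Fin (Lc ^ j),
          w (bpt (Lc ^ j) M y a + tstep (fine (Lc ^ j) M) ν t, ν)‖
      = 1 / ((Lc ^ j : ℕ) : ℝ) ^ (d + 1) * ‖∑ a : Fin d → Fin (Lc ^ j), ∑ t : Fin (Lc ^ j),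
          w (bpt (Lc ^ j) M y a + tstep (fine (Lc ^ j) M) ν t, ν)‖ := by
        rw [norm_mul, norm_div, norm_one, norm_pow, Complex.norm_natCast]
    _ ≤ 1 / ((Lc ^ j : ℕ) : ℝ) ^ (d + 1) * ∑ _a : Fin d → Fin (Lc ^ j), ∑ _t : Fin (Lc ^ j), W := by
        gcongr
        exact (norm_sum_le _ _).trans (sum_le_sum fun a _ => (norm_sum_le _ _).trans (sum_le_sum fun t _ => hW _))
    _ = W := by
        have hL : (Lc : ℝ) ≠ 0 := Nat.cast_ne_zero.mpr (NeZero.ne Lc)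
        rw [sum_const, card_univ, nsmul_eq_mul, sum_const, card_univ, nsmul_eq_mul, Fintype.card_fun, Fintype.card_fin, Fintype.card_fin]
        push_cast
        field_simp
        ring

/-- **(1.17) FACTORS THE HONEST DEFECT THROUGH ONE STEP**: `sread (j+1) (PcoMat j (H B)) − B = sread j ((cstep j·PcoMat j − 1)(H B))`
(`MonotoneTorusTower.sread_comp` and `Q_{Lc^j}H_{Lc^j} = 1`, `B5Hk163Torus.QvOp_HkOp_mulVec`). [folklore] -/
theorem honestDefect_eq_sread (j : ℕ) (B : Tor M × Fin d → ℂ) :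
    sread Lc M (j + 1) *ᵥ (PcoMat Lc M j *ᵥ (HkOp (Lc ^ j) M *ᵥ B)) - B
      = sread Lc M j *ᵥ (cstep Lc M j *ᵥ (PcoMat Lc M j *ᵥ (HkOp (Lc ^ j) M *ᵥ B)) - HkOp (Lc ^ j) M *ᵥ B) := by
  have hB : sread Lc M j *ᵥ (HkOp (Lc ^ j) M *ᵥ B) = B := QvOp_HkOp_mulVec (Lc ^ j) M B
  rw [mulVec_sub, hB]
  conv_rhs => rw [mulVec_mulVec, sread_comp]

end Defect

/-! ## §4 The size of the honest defect: `nsq δ_j(B) ≤ ρ_j²·nsq B`, `ρ_j = |T₁×{1..d}|·(Lc + d)·C_H(d,0)·Lc^{−j}` -/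

section Size

variable (Lc : ℕ) [NeZero Lc] (M : Fin d → ℕ) [hM : ∀ μ, NeZero (M μ)]

/-- **THE SIZE OF THE HONEST ROW DEFECT OF BAŁABAN's MINIMISER UNDER WHITNEY PROLONGATION** (the input `hδ` of `WhitneyRowDefectGauge.squeeze_nsq_honest` ∕
`curlEnergy_HkOp_succ_sub_PcoLev_le`, hypothesis-free): for every `d`, every `Lc ≥ 1`, every unit torus `M`, every level `j` and every datum `B`,
`nsq (Q_{Lc^{j+1}}(PcoMat j (H_{Lc^j}B)) − B) ≤ (|T₁×{1..d}|·(Lc + d)·C_H(d,0)∕Lc^j)²·nsq B` — first order in `η_j = Lc^{−j}`; the unit-torus volume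
`|T₁×{1..d}| = Fintype.card (Tor M × Fin d)` enters through the crude sup bound and Cauchy–Schwarz `(Σ|B|)² ≤ |T₁×{1..d}|·nsq B`. [folklore] -/
theorem nsq_honestDefect_le (j : ℕ) (B : Tor M × Fin d → ℂ) :
    nsq (sread Lc M (j + 1) *ᵥ (PcoMat Lc M j *ᵥ (HkOp (Lc ^ j) M *ᵥ B)) - B)
      ≤ ((Fintype.card (Tor M × Fin d) : ℝ) * ((Lc : ℝ) + d) * CHolder163 d 0 / (Lc : ℝ) ^ j) ^ 2 * nsq B := by
  set β := ∑ y : Tor M, ∑ lam : Fin d, ‖B (y, lam)‖ with hβ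
  set W := ((Lc : ℝ) + d) * (CHolder163 d 0 / ((Lc ^ j : ℕ) : ℝ) * β) with hW
  have hpt : ∀ i, ‖(sread Lc M (j + 1) *ᵥ (PcoMat Lc M j *ᵥ (HkOp (Lc ^ j) M *ᵥ B)) - B) i‖ ≤ W := by
    rintro ⟨y, ν⟩
    rw [honestDefect_eq_sread]
    exact norm_sread_mulVec_le Lc M j _ (fun k => by
      obtain ⟨z, μ⟩ := k
      rw [Pi.sub_apply]
      exact norm_cstep_PcoMat_sub_le Lc M j B z μ) y ν
  have hβsq : β ^ 2 ≤ (Fintype.card (Tor M × Fin d) : ℝ) * nsq B := by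
    have h := sq_sum_le_card_mul_sum_sq (s := (univ : Finset (Tor M × Fin d))) (f := fun i => ‖B i‖)
    rw [card_univ] at h
    have e : β = ∑ i : Tor M × Fin d, ‖B i‖ := by rw [hβ, Fintype.sum_prod_type]
    rw [e]
    exact h
  have hfac : 0 ≤ (Fintype.card (Tor M × Fin d) : ℝ) * (((Lc : ℝ) + d) ^ 2 * (CHolder163 d 0 / ((Lc ^ j : ℕ) : ℝ)) ^ 2) := by positivity
  calc nsq (sread Lc M (j + 1) *ᵥ (PcoMat Lc M j *ᵥ (HkOp (Lc ^ j) M *ᵥ B)) - B)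
      = ∑ i : Tor M × Fin d, ‖(sread Lc M (j + 1) *ᵥ (PcoMat Lc M j *ᵥ (HkOp (Lc ^ j) M *ᵥ B)) - B) i‖ ^ 2 := rfl
    _ ≤ ∑ _i : Tor M × Fin d, W ^ 2 := sum_le_sum fun i _ => pow_le_pow_left₀ (norm_nonneg _) (hpt i) 2
    _ = (Fintype.card (Tor M × Fin d) : ℝ) * (((Lc : ℝ) + d) ^ 2 * (CHolder163 d 0 / ((Lc ^ j : ℕ) : ℝ)) ^ 2) * β ^ 2 := by
        rw [sum_const, card_univ, nsmul_eq_mul, hW]; ring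
    _ ≤ (Fintype.card (Tor M × Fin d) : ℝ) * (((Lc : ℝ) + d) ^ 2 * (CHolder163 d 0 / ((Lc ^ j : ℕ) : ℝ)) ^ 2)
          * ((Fintype.card (Tor M × Fin d) : ℝ) * nsq B) := mul_le_mul_of_nonneg_left hβsq hfac
    _ = ((Fintype.card (Tor M × Fin d) : ℝ) * ((Lc : ℝ) + d) * CHolder163 d 0 / (Lc : ℝ) ^ j) ^ 2 * nsq B := by
        rw [Nat.cast_pow]; ring

end Size

end Summit.QuantumFields.BalabanUV.Beta.GAN24.WhitneyRowDefectBound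

end
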